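/-
Copyright (c) 2026 the pub-hodgecm-mathlib formalisation cell (harness21).  Prover seat hodgecm-mathlib-K2E3-p12 (g4), Track B «K2-LIT» ∕ h413
(`stmt-HodgeConjecture-24833`), line `K2_E3_EllipticInputs`, unit U12-d, §L (Φ′-d, part 3): (L-B_U)′ AT `N = 2` FROM `(L-B_GL)^{Nm}` ON `𝔤𝔩₂(L⁺_v)` — THE CM GLUE.
2026-09-04.
-/
import Summits.HodgeConjecture.HodgeConjecture.Theorems.K2E3U2NilpotentFourierPointSupport          -- ★ p856833 (K2E3-p16): the ANISOTROPIC case verbatim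
import Summits.HodgeConjecture.HodgeConjecture.Theorems.K2E3U11NilpotentInvariantTransport         -- ★ p857242 (this seat): transport of `J(𝒩)` + regularity along `Φ`
import Summits.HodgeConjecture.HodgeConjecture.Theorems.K2E3LieUnitaryNilpotentFourierRegularCongr  -- ★ p857270 (this seat): the :373 body is a congruence invariant
import Summits.HodgeConjecture.HodgeConjecture.Theorems.K2E3HermitianPlaneIsotropicCongr           -- ★ p857279 (this seat): isotropic plane `~ J₀`
import Summits.HodgeConjecture.HodgeConjecture.Theorems.K2E3GLnNilpotentFourierPointSupport        -- ★ p856457 (K2E3-p16): `isLocSmooth_matrixFourier`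
import Literature.NumberTheory.LocalFields.FiniteEmbeddingNormAbs                                   -- ★ (NB) `normAbs_map_eq_sq_of_involution`
import Literature.NumberTheory.Automorphic.QuadraticLocalBaseChange                                 -- ★ `continuous_toPlace`
import HarnessLib

/-!
# K2_E3 road (h413), §L — (Φ′-d, part 3): (L-B_U)′ `sig_K2E3UNilpotentFourierRegular` at `N = 2`, EVERY `H`, from the one analytic input «(L-B_GL)^{Nm} on `𝔤𝔩₂(L⁺_v)`»

Cell `pub/hodgecm-mathlib` (D-0151), Track B, seat K2E3-p12 (g4), §L line lead (MEMO v3, road «U-iso-T»).  `--supports stmt-HodgeConjecture-24833 --as helper`;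
count-neutral plumbing toward the hosted socket (L-B_U)′ (U12 ED. 7 :373).

* §1 **`hyperbolic_nilpotentFourierRegular_of_gl2Nm`** — the :373 body for the HYPERBOLIC PLANE `𝔲(σ_w, J₀)`, `J₀ = !![0,1;1,0]`, from the hypothesis `hGL` =
  «(L-B_GL)^{Nm}»: every `T′` on `C_c^∞(𝔤𝔩₂(L⁺_v))` with (i) (ii) (iv) and `Ad(g)`-invariance for all `g` with `ι(det g) ∈ Nm(L_wˣ)` has a Fourier transform represented by a
  locally integrable function, locally constant on `{disc ∈ (L⁺_v)ˣ}`, `|disc|^{1∕2}·‖·‖` locally bounded (for the character `ψ ∘ ι` and every Haar measure).  Proof: quadratic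
  coordinates ★ `exists_quadraticCoordinates`, the transport `Φ` ★ `exists_lieTransport`, ★ p857242 `nilpotentFourierRegular_of_transport` with `ω_E = |·|_w^{1∕4}`,
  `ω_F = |·|_v^{1∕2}` (★ (NB) `|ι y|_w = |y|_v²`), `C_c^∞`-stability of `𝓕_{𝔤𝔩₂}` ★ `isLocSmooth_matrixFourier` for `ψ ∘ ι` (non-trivial by the repaired antecedent of :373).
* §2 **`u2_nilpotentFourierRegular_of_gl2Nm`** — (L-B_U)′ ED. 7 :373 VERBATIM at `N := 2` for EVERY hermitian `H` with `det H ≠ 0`, under the single extra hypothesis `hGL`: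
  dichotomy ★ p857279; anisotropic ↦ ★ p856833 `u2_nilpotentFourierRegular_of_anisotropic`; isotropic ↦ ★ p857270 `nilpotentFourierRegular_of_formCongr` ∘ §1.

HONEST LABEL: HC_CM is proved only modulo the 7 printed citations (2 remaining named inputs: hLiu418 = stmt-HodgeConjecture-24832, h413 = stmt-HodgeConjecture-24833)
until rung 0 closes; count-neutral plumbing.  `hGL` is a NAMED RESIDUAL (to be hosted as a sub-leaf of :373; it is Harish-Chandra's Thm. 4.4 for the two `G⁺`-orbits
separately — ★ p857116 gives the structure `T′ = c₀δ₀ + c₊ν_{𝒪₊} + c₋ν_{𝒪₋}`).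

References: [HarishChandra1999AdmissibleDistributions] Harish-Chandra (DeBacker–Sally), *Admissible Invariant Distributions on Reductive p-adic Groups* (1999), Thm. 4.4 p. 11,
§21 p. 87; [PlatonovRapinchuk1994] Platonov–Rapinchuk (1994), §2.3; [WeilBNT1967] Weil, *Basic Number Theory* (1967), Ch. I §2, Ch. VII §2 Prop. 2;
[Scharlau1985HermitianForms] Scharlau (1985), Ch. 7 §1.
-/

set_option autoImplicit false
set_option linter.dupNamespace false   -- `Summit.HodgeConjecture.HodgeConjecture.…` (D-0017 nested layout; lakefile exemption for Summits)

noncomputable section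

open MeasureTheory Filter Topology NumberField IsDedekindDomain
open scoped Matrix MatrixGroups NNReal
open Literature.NumberTheory.Rogawski1990 Literature.NumberTheory.Automorphic Literature.NumberTheory.Automorphic.UnitaryGroup Literature.NumberTheory.Automorphic.LocalFieldHaar
open Literature.NumberTheory.GaloisRepresentations Literature.NumberTheory.GaloisRepresentations.IsNonarchimedeanLocalField
open Summit.HodgeConjecture.HodgeConjecture.Cruxes.H413.K2E3LieUnitary
open Summit.HodgeConjecture.HodgeConjecture.Cruxes.H413.K2E3U2DiscrInvFourthRootLocallyIntegrable (exists_quadraticCoordinates)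
open Summit.HodgeConjecture.HodgeConjecture.Cruxes.H413.K2E3U11LieTransport (exists_lieTransport)
open Summit.HodgeConjecture.HodgeConjecture.Cruxes.H413.K2E3U11NilpotentInvariantTransport
open Summit.HodgeConjecture.HodgeConjecture.Cruxes.H413.K2E3LieUnitaryNilpotentFourierRegularCongr (nilpotentFourierRegular_of_formCongr)
open Summit.HodgeConjecture.HodgeConjecture.Cruxes.H413.K2E3HermitianPlaneIsotropicCongr (anisotropic_or_exists_formCongr_eq_hyperbolic)
open Summit.HodgeConjecture.HodgeConjecture.Cruxes.H413.K2E3GLnNilpotentFourierPointSupport (isLocSmooth_matrixFourier)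
open Summit.HodgeConjecture.HodgeConjecture.Cruxes.H413.K2E3U2NilpotentFourierPointSupport (u2_nilpotentFourierRegular_of_anisotropic)

namespace Summit.HodgeConjecture.HodgeConjecture.Cruxes.H413.K2E3U2NilpotentFourierRegularOfGL2

variable (L : Type) [Field L] [NumberField L] [IsCMField L] (v : HeightOneSpectrum (𝓞 ↥(maximalRealSubfield L)))
  (w : UnitaryGroup.PlacesOver L v) (hw : IsCMField.complexConj L • w.1 = w.1)

/-! ## §1  The hyperbolic plane `𝔲(σ_w, J₀)` from `𝔤𝔩₂(L⁺_v)` -/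

/-- **(L-B_U)′-body for the HYPERBOLIC PLANE from «(L-B_GL)^{Nm} on `𝔤𝔩₂(L⁺_v)`»** (stated for any `J′` literally equal to `J₀ = !![0,1;1,0]`, so that congruence targets
`ᵗ(σP)·H_w·P` can be substituted).  [cite: HarishChandra1999AdmissibleDistributions, Thm. 4.4 p. 11, §21 p. 87] [cite: PlatonovRapinchuk1994, §2.3]
[cite: WeilBNT1967, Ch. I §2, Ch. VII §2 Prop. 2] -/
theorem hyperbolic_nilpotentFourierRegular_of_gl2Nm (ψ : AddChar (w.1.adicCompletion L) Circle) (hψ : ψ.IsContinuousNontrivial)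
    (hψι : ∃ a : w.1.adicCompletion L, galAdicCompletionMap (L := L) (IsCMField.complexConj L) hw a = a ∧ ψ a ≠ 1)
    (hGL : ∀ [MeasurableSpace (Matrix (Fin 2) (Fin 2) (v.adicCompletion ↥(maximalRealSubfield L)))] [BorelSpace (Matrix (Fin 2) (Fin 2) (v.adicCompletion ↥(maximalRealSubfield L)))] (μ' : Measure (Matrix (Fin 2) (Fin 2) (v.adicCompletion ↥(maximalRealSubfield L)))) [μ'.IsAddHaarMeasure]
      (T' : ((Matrix (Fin 2) (Fin 2) (v.adicCompletion ↥(maximalRealSubfield L))) → ℂ) → ℂ),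
      (∀ f₁ f₂ : (Matrix (Fin 2) (Fin 2) (v.adicCompletion ↥(maximalRealSubfield L))) → ℂ, IsLocSmooth f₁ → IsLocSmooth f₂ → T' (f₁ + f₂) = T' f₁ + T' f₂) →
      (∀ (a : ℂ) (f : (Matrix (Fin 2) (Fin 2) (v.adicCompletion ↥(maximalRealSubfield L))) → ℂ), IsLocSmooth f → T' (a • f) = a * T' f) →
      (∀ g : GL (Fin 2) (v.adicCompletion ↥(maximalRealSubfield L)), (∃ e : w.1.adicCompletion L, toPlace v w ((g : Matrix (Fin 2) (Fin 2) (v.adicCompletion ↥(maximalRealSubfield L))).det) * (e * galAdicCompletionMap (L := L) (IsCMField.complexConj L) hw e) = 1) →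
        ∀ f : (Matrix (Fin 2) (Fin 2) (v.adicCompletion ↥(maximalRealSubfield L))) → ℂ, IsLocSmooth f → T' (fun X => f ((g : Matrix (Fin 2) (Fin 2) (v.adicCompletion ↥(maximalRealSubfield L))) * X * ((g⁻¹ : GL (Fin 2) (v.adicCompletion ↥(maximalRealSubfield L))) : Matrix (Fin 2) (Fin 2) (v.adicCompletion ↥(maximalRealSubfield L))))) = T' f) →
      (∀ f : (Matrix (Fin 2) (Fin 2) (v.adicCompletion ↥(maximalRealSubfield L))) → ℂ, IsLocSmooth f → (∀ X ∈ tsupport f, ¬ IsNilpotent X) → T' f = 0) →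
      ∃ Fn' : (Matrix (Fin 2) (Fin 2) (v.adicCompletion ↥(maximalRealSubfield L))) → ℂ, LocallyIntegrable Fn' μ' ∧
        (∀ f : (Matrix (Fin 2) (Fin 2) (v.adicCompletion ↥(maximalRealSubfield L))) → ℂ, IsLocSmooth f →
          T' (fun Y => ∫ X, ((ψ (toPlace v w (Matrix.trace (Y * X))) : Circle) : ℂ) * f X ∂μ') = ∫ X, f X * Fn' X ∂μ') ∧
        (∀ X : Matrix (Fin 2) (Fin 2) (v.adicCompletion ↥(maximalRealSubfield L)), IsUnit X.charpoly.discr → ∀ᶠ Y in 𝓝 X, Fn' Y = Fn' X) ∧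
        (∀ C : Set (Matrix (Fin 2) (Fin 2) (v.adicCompletion ↥(maximalRealSubfield L))), IsCompact C → ∃ B : ℝ, ∀ X ∈ C, ((NNReal.sqrt (normAbs (v.adicCompletion ↥(maximalRealSubfield L)) X.charpoly.discr) : ℝ≥0) : ℝ) * ‖Fn' X‖ ≤ B))
    (J' : Matrix (Fin 2) (Fin 2) (w.1.adicCompletion L)) (hJ' : J' = !![(0 : w.1.adicCompletion L), 1; 1, 0])
    [MeasurableSpace ↥(lieOfForm (galAdicCompletionMap (L := L) (IsCMField.complexConj L) hw) J')] [BorelSpace ↥(lieOfForm (galAdicCompletionMap (L := L) (IsCMField.complexConj L) hw) J')] (μ' : Measure ↥(lieOfForm (galAdicCompletionMap (L := L) (IsCMField.complexConj L) hw) J')) [μ'.IsAddHaarMeasure]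
    (T' : (↥(lieOfForm (galAdicCompletionMap (L := L) (IsCMField.complexConj L) hw) J') → ℂ) → ℂ)
    (hT' : ((∀ f₁ f₂ : ↥(lieOfForm (galAdicCompletionMap (L := L) (IsCMField.complexConj L) hw) J') → ℂ, IsLocSmooth f₁ → IsLocSmooth f₂ → T' (f₁ + f₂) = T' f₁ + T' f₂) ∧
         (∀ (a : ℂ) (f : ↥(lieOfForm (galAdicCompletionMap (L := L) (IsCMField.complexConj L) hw) J') → ℂ), IsLocSmooth f → T' (a • f) = a * T' f) ∧
         (∀ (x : ↥(unitaryGroupOfForm (galAdicCompletionMap (L := L) (IsCMField.complexConj L) hw) J')) (f : ↥(lieOfForm (galAdicCompletionMap (L := L) (IsCMField.complexConj L) hw) J') → ℂ), IsLocSmooth f →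
            T' (fun X => f ⟨((x : GL (Fin 2) (w.1.adicCompletion L)) : Matrix (Fin 2) (Fin 2) (w.1.adicCompletion L)) * X.1 * (((x : GL (Fin 2) (w.1.adicCompletion L))⁻¹ : GL (Fin 2) (w.1.adicCompletion L)) : Matrix (Fin 2) (Fin 2) (w.1.adicCompletion L)),
              conj_mem_lieOfForm x.2 X.2⟩) = T' f) ∧
         (∀ f : ↥(lieOfForm (galAdicCompletionMap (L := L) (IsCMField.complexConj L) hw) J') → ℂ, IsLocSmooth f → (∀ X ∈ tsupport f, ¬ IsNilpotent X.1) → T' f = 0))) :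
    ∃ Fn : ↥(lieOfForm (galAdicCompletionMap (L := L) (IsCMField.complexConj L) hw) J') → ℂ, LocallyIntegrable Fn μ' ∧
          (∀ f : ↥(lieOfForm (galAdicCompletionMap (L := L) (IsCMField.complexConj L) hw) J') → ℂ, IsLocSmooth f → T' (lieFourier (galAdicCompletionMap (L := L) (IsCMField.complexConj L) hw) J' (fun x : w.1.adicCompletion L => ((ψ x : Circle) : ℂ)) μ' f) = ∫ X, f X * Fn X ∂μ') ∧
          (∀ X : ↥(lieOfForm (galAdicCompletionMap (L := L) (IsCMField.complexConj L) hw) J'), IsUnit X.1.charpoly.discr → ∀ᶠ Y in 𝓝 X, Fn Y = Fn X) ∧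
          (∀ C : Set ↥(lieOfForm (galAdicCompletionMap (L := L) (IsCMField.complexConj L) hw) J'), IsCompact C → ∃ B : ℝ, ∀ X ∈ C,
              ((NNReal.sqrt (NNReal.sqrt (normAbs (w.1.adicCompletion L) X.1.charpoly.discr)) : ℝ≥0) : ℝ) * ‖Fn X‖ ≤ B) := by
  subst hJ'
  classical
  obtain ⟨hT1, hT2, hT3, hT4⟩ := hT'
  -- the quadratic frame at `w ∣ v`
  haveI : Algebra.IsQuadraticExtension ↥(maximalRealSubfield L) L := IsCMField.isQuadraticExtension L
  have hc1 := IsCMField.complexConj_ne_one L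
  have hσσ : ∀ x, galAdicCompletionMap (L := L) (IsCMField.complexConj L) hw (galAdicCompletionMap (L := L) (IsCMField.complexConj L) hw x) = x :=
    galAdicCompletionMap_galAdicCompletionMap_of_smul_eq (IsCMField.complexConj L) w hc1 hw
  have hσι : ∀ r, galAdicCompletionMap (L := L) (IsCMField.complexConj L) hw (toPlace v w r) = toPlace v w r := fun r =>
    (galAdicCompletionMap_eq_self_iff_mem_range (IsCMField.complexConj L) hc1 v w hw _).2 ⟨r, rfl⟩
  have hιr : ∀ y : w.1.adicCompletion L, galAdicCompletionMap (L := L) (IsCMField.complexConj L) hw y = y ↔ y ∈ Set.range (toPlace v w) :=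
    fun y => galAdicCompletionMap_eq_self_iff_mem_range (IsCMField.complexConj L) hc1 v w hw y
  have h2 : (2 : w.1.adicCompletion L) ≠ 0 := two_ne_zero
  obtain ⟨lam, d, ρ, hσl, hd, hd0, hρc, hρ1, hρ2⟩ := exists_quadraticCoordinates L v w hw
  have hl0 : lam ≠ 0 := fun h => by
    rw [h, mul_zero] at hd
    exact hd0 ((map_eq_zero (toPlace v w)).1 hd.symm)
  obtain ⟨Φ, hΦc, hΦs, hΦ⟩ := exists_lieTransport (galAdicCompletionMap (L := L) (IsCMField.complexConj L) hw) (toPlace v w) (continuous_toPlace v w) lam ρ hρc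
    hρ1 hρ2 hσι hσl h2 d hd0
  -- Borel structures on `𝔤𝔩₂(L⁺_v)`; `Φ_* μ′` is Haar
  letI : MeasurableSpace (Matrix (Fin 2) (Fin 2) (v.adicCompletion ↥(maximalRealSubfield L))) := borel _
  haveI : BorelSpace (Matrix (Fin 2) (Fin 2) (v.adicCompletion ↥(maximalRealSubfield L))) := ⟨rfl⟩
  haveI hHaar : (μ'.map Φ).IsAddHaarMeasure :=
    K2E3U11LieTransportFourier.isAddHaarMeasure_map_lieTransport (galAdicCompletionMap (L := L) (IsCMField.complexConj L) hw) Φ hΦc hΦs μ'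
  -- the character `ψ ∘ ι` on `L⁺_v` is continuous and non-trivial
  let ψF : AddChar (v.adicCompletion ↥(maximalRealSubfield L)) Circle := ψ.compAddMonoidHom (toPlace v w).toAddMonoidHom
  have hψF_apply : ∀ t, ψF t = ψ (toPlace v w t) := fun t => rfl
  have hψF : ψF.IsContinuousNontrivial := by
    refine ⟨hψ.1.comp (continuous_toPlace v w), fun h0 => ?_⟩
    obtain ⟨a, ha, hψa⟩ := hψι
    obtain ⟨r, rfl⟩ := (hιr a).1 ha
    have : ψF r = 1 := by rw [h0]; rfl
    exact hψa (by rw [← hψF_apply]; exact this)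
  -- `C_c^∞`-stability of `𝓕_{𝔤𝔩₂}` for `ψ ∘ ι`
  have hFs : ∀ h : (Matrix (Fin 2) (Fin 2) (v.adicCompletion ↥(maximalRealSubfield L))) → ℂ, IsLocSmooth h →
      IsLocSmooth (fun Y' : Matrix (Fin 2) (Fin 2) (v.adicCompletion ↥(maximalRealSubfield L)) => ∫ X', (fun x : w.1.adicCompletion L => ((ψ x : Circle) : ℂ)) (toPlace v w (Matrix.trace (Y' * X'))) * h X' ∂(μ'.map Φ)) :=
    fun h hh => isLocSmooth_matrixFourier hψF (μ'.map Φ) hh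
  -- the weights: `|ι y|_w^{1∕4} = |y|_v^{1∕2}`
  haveI : Invertible (2 : w.1.adicCompletion L) := invertibleOfNonzero h2
  have hNB : ∀ y : v.adicCompletion ↥(maximalRealSubfield L), normAbs (w.1.adicCompletion L) (toPlace v w y) = normAbs (v.adicCompletion ↥(maximalRealSubfield L)) y ^ 2 := fun y =>
    Literature.NumberTheory.LocalFields.normAbs_map_eq_sq_of_involution (toPlace v w) (continuous_toPlace v w)
      (galAdicCompletionMap (L := L) (IsCMField.complexConj L) hw) hσσ hιr (Units.mk0 lam hl0) hσl y
  have hω : ∀ y : v.adicCompletion ↥(maximalRealSubfield L), (fun x : w.1.adicCompletion L => ((NNReal.sqrt (NNReal.sqrt (normAbs (w.1.adicCompletion L) x)) : ℝ≥0) : ℝ)) (toPlace v w y) = ((NNReal.sqrt (normAbs (v.adicCompletion ↥(maximalRealSubfield L)) y) : ℝ≥0) : ℝ) := fun y => by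
    simp only [hNB, NNReal.sqrt_sq]
  -- the transported functional satisfies the hypotheses of `hGL`
  have hsm : ∀ f' : (Matrix (Fin 2) (Fin 2) (v.adicCompletion ↥(maximalRealSubfield L))) → ℂ, IsLocSmooth f' → IsLocSmooth (fun X : ↥(lieOfForm (galAdicCompletionMap (L := L) (IsCMField.complexConj L) hw) !![(0 : w.1.adicCompletion L), 1; 1, 0]) => f' (Φ X)) := fun f' hf' =>
    isLocSmooth_comp_lieTransport (galAdicCompletionMap (L := L) (IsCMField.complexConj L) hw) Φ hΦc hΦs hf'
  obtain ⟨Fn', hFn'i, hFn'T, hFn'c, hFn'b⟩ := hGL (μ'.map Φ) (fun f' => T' (fun X => f' (Φ X)))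
    (fun f₁ f₂ h₁ h₂ => hT1 _ _ (hsm _ h₁) (hsm _ h₂))
    (fun a f hf => hT2 a _ (hsm _ hf))
    (fun g he f hf => by
      obtain ⟨e, he⟩ := he
      exact transport_conj_invariant (galAdicCompletionMap (L := L) (IsCMField.complexConj L) hw) (toPlace v w) lam ρ hρ1 hσι hσl h2 d hd hl0 Φ hΦ T' hT3
        g e he f (hsm _ hf))
    (fun f hf hN => transport_pointSupport (galAdicCompletionMap (L := L) (IsCMField.complexConj L) hw) (toPlace v w) lam ρ hρ1 hσι hσl h2 d hd hl0 Φ hΦc hΦs hΦ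
      T' hT4 f hf hN)
  -- read back on `𝔲(σ_w, J₀)`
  exact nilpotentFourierRegular_of_transport (galAdicCompletionMap (L := L) (IsCMField.complexConj L) hw) (toPlace v w) lam ρ hρ1 hσι hσl h2 d hd hl0 Φ hΦc hΦs hΦ
    T' hT1 hT4 (fun x : w.1.adicCompletion L => ((ψ x : Circle) : ℂ)) μ' hFs (fun x : w.1.adicCompletion L => ((NNReal.sqrt (NNReal.sqrt (normAbs (w.1.adicCompletion L) x)) : ℝ≥0) : ℝ)) (fun y => ((NNReal.sqrt (normAbs (v.adicCompletion ↥(maximalRealSubfield L)) y) : ℝ≥0) : ℝ)) hω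
    ⟨Fn', hFn'i, hFn'T, fun X' hX' => hFn'c X' (isUnit_iff_ne_zero.2 hX'), hFn'b⟩

/-! ## §2  (L-B_U)′ at `N = 2` for every `H` -/

include hw in
/-- **(L-B_U)′ (U12 ED. 7 :373) AT `N := 2`, EVERY HERMITIAN `H` WITH `det H ≠ 0`, FROM «(L-B_GL)^{Nm} ON `𝔤𝔩₂(L⁺_v)`»** (`hGL`, the one remaining analytic input of
the §L road at `N = 2`): `H_w` is anisotropic (★ p856833) or congruent to the hyperbolic plane (★ p857279), and the :373 body is a congruence invariant (★ p857270) which §1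
supplies for `J₀`. [cite: HarishChandra1999AdmissibleDistributions, Thm. 4.4 p. 11, §21 p. 87] [cite: PlatonovRapinchuk1994, §2.3] [cite: Scharlau1985HermitianForms, Ch. 7 §1] -/
theorem u2_nilpotentFourierRegular_of_gl2Nm (H : Matrix (Fin 2) (Fin 2) L) (hH : (H.map (cmConjRingHom L))ᵀ = H) (hdet : H.det ≠ 0)
    (ψ : AddChar (w.1.adicCompletion L) Circle) (hψ : ψ.IsContinuousNontrivial)
    (hψι : ∃ a : w.1.adicCompletion L, galAdicCompletionMap (L := L) (IsCMField.complexConj L) hw a = a ∧ ψ a ≠ 1)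
    (hGL : ∀ [MeasurableSpace (Matrix (Fin 2) (Fin 2) (v.adicCompletion ↥(maximalRealSubfield L)))] [BorelSpace (Matrix (Fin 2) (Fin 2) (v.adicCompletion ↥(maximalRealSubfield L)))] (μ' : Measure (Matrix (Fin 2) (Fin 2) (v.adicCompletion ↥(maximalRealSubfield L)))) [μ'.IsAddHaarMeasure]
      (T' : ((Matrix (Fin 2) (Fin 2) (v.adicCompletion ↥(maximalRealSubfield L))) → ℂ) → ℂ),
      (∀ f₁ f₂ : (Matrix (Fin 2) (Fin 2) (v.adicCompletion ↥(maximalRealSubfield L))) → ℂ, IsLocSmooth f₁ → IsLocSmooth f₂ → T' (f₁ + f₂) = T' f₁ + T' f₂) →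
      (∀ (a : ℂ) (f : (Matrix (Fin 2) (Fin 2) (v.adicCompletion ↥(maximalRealSubfield L))) → ℂ), IsLocSmooth f → T' (a • f) = a * T' f) →
      (∀ g : GL (Fin 2) (v.adicCompletion ↥(maximalRealSubfield L)), (∃ e : w.1.adicCompletion L, toPlace v w ((g : Matrix (Fin 2) (Fin 2) (v.adicCompletion ↥(maximalRealSubfield L))).det) * (e * galAdicCompletionMap (L := L) (IsCMField.complexConj L) hw e) = 1) →
        ∀ f : (Matrix (Fin 2) (Fin 2) (v.adicCompletion ↥(maximalRealSubfield L))) → ℂ, IsLocSmooth f → T' (fun X => f ((g : Matrix (Fin 2) (Fin 2) (v.adicCompletion ↥(maximalRealSubfield L))) * X * ((g⁻¹ : GL (Fin 2) (v.adicCompletion ↥(maximalRealSubfield L))) : Matrix (Fin 2) (Fin 2) (v.adicCompletion ↥(maximalRealSubfield L))))) = T' f) →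
      (∀ f : (Matrix (Fin 2) (Fin 2) (v.adicCompletion ↥(maximalRealSubfield L))) → ℂ, IsLocSmooth f → (∀ X ∈ tsupport f, ¬ IsNilpotent X) → T' f = 0) →
      ∃ Fn' : (Matrix (Fin 2) (Fin 2) (v.adicCompletion ↥(maximalRealSubfield L))) → ℂ, LocallyIntegrable Fn' μ' ∧
        (∀ f : (Matrix (Fin 2) (Fin 2) (v.adicCompletion ↥(maximalRealSubfield L))) → ℂ, IsLocSmooth f →
          T' (fun Y => ∫ X, ((ψ (toPlace v w (Matrix.trace (Y * X))) : Circle) : ℂ) * f X ∂μ') = ∫ X, f X * Fn' X ∂μ') ∧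
        (∀ X : Matrix (Fin 2) (Fin 2) (v.adicCompletion ↥(maximalRealSubfield L)), IsUnit X.charpoly.discr → ∀ᶠ Y in 𝓝 X, Fn' Y = Fn' X) ∧
        (∀ C : Set (Matrix (Fin 2) (Fin 2) (v.adicCompletion ↥(maximalRealSubfield L))), IsCompact C → ∃ B : ℝ, ∀ X ∈ C, ((NNReal.sqrt (normAbs (v.adicCompletion ↥(maximalRealSubfield L)) X.charpoly.discr) : ℝ≥0) : ℝ) * ‖Fn' X‖ ≤ B))
    [MeasurableSpace ↥(lieOfForm (galAdicCompletionMap (L := L) (IsCMField.complexConj L) hw) (UnitaryGroup.placeForm H w.1))] [BorelSpace ↥(lieOfForm (galAdicCompletionMap (L := L) (IsCMField.complexConj L) hw) (UnitaryGroup.placeForm H w.1))] (μ𝔤 : Measure ↥(lieOfForm (galAdicCompletionMap (L := L) (IsCMField.complexConj L) hw) (UnitaryGroup.placeForm H w.1))) [μ𝔤.IsAddHaarMeasure]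
    (T : (↥(lieOfForm (galAdicCompletionMap (L := L) (IsCMField.complexConj L) hw) (UnitaryGroup.placeForm H w.1)) → ℂ) → ℂ)
    (hT : ((∀ f₁ f₂ : ↥(lieOfForm (galAdicCompletionMap (L := L) (IsCMField.complexConj L) hw) (UnitaryGroup.placeForm H w.1)) → ℂ, IsLocSmooth f₁ → IsLocSmooth f₂ → T (f₁ + f₂) = T f₁ + T f₂) ∧
         (∀ (a : ℂ) (f : ↥(lieOfForm (galAdicCompletionMap (L := L) (IsCMField.complexConj L) hw) (UnitaryGroup.placeForm H w.1)) → ℂ), IsLocSmooth f → T (a • f) = a * T f) ∧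
         (∀ (x : ↥(unitaryGroupOfForm (galAdicCompletionMap (L := L) (IsCMField.complexConj L) hw) (UnitaryGroup.placeForm H w.1))) (f : ↥(lieOfForm (galAdicCompletionMap (L := L) (IsCMField.complexConj L) hw) (UnitaryGroup.placeForm H w.1)) → ℂ), IsLocSmooth f →
            T (fun X => f ⟨((x : GL (Fin 2) (w.1.adicCompletion L)) : Matrix (Fin 2) (Fin 2) (w.1.adicCompletion L)) * X.1 * (((x : GL (Fin 2) (w.1.adicCompletion L))⁻¹ : GL (Fin 2) (w.1.adicCompletion L)) : Matrix (Fin 2) (Fin 2) (w.1.adicCompletion L)),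
              conj_mem_lieOfForm x.2 X.2⟩) = T f) ∧
         (∀ f : ↥(lieOfForm (galAdicCompletionMap (L := L) (IsCMField.complexConj L) hw) (UnitaryGroup.placeForm H w.1)) → ℂ, IsLocSmooth f → (∀ X ∈ tsupport f, ¬ IsNilpotent X.1) → T f = 0))) :
    ∃ Fn : ↥(lieOfForm (galAdicCompletionMap (L := L) (IsCMField.complexConj L) hw) (UnitaryGroup.placeForm H w.1)) → ℂ, LocallyIntegrable Fn μ𝔤 ∧
          (∀ f : ↥(lieOfForm (galAdicCompletionMap (L := L) (IsCMField.complexConj L) hw) (UnitaryGroup.placeForm H w.1)) → ℂ, IsLocSmooth f → T (lieFourier (galAdicCompletionMap (L := L) (IsCMField.complexConj L) hw) (UnitaryGroup.placeForm H w.1) (fun x : w.1.adicCompletion L => ((ψ x : Circle) : ℂ)) μ𝔤 f) = ∫ X, f X * Fn X ∂μ𝔤) ∧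
          (∀ X : ↥(lieOfForm (galAdicCompletionMap (L := L) (IsCMField.complexConj L) hw) (UnitaryGroup.placeForm H w.1)), IsUnit X.1.charpoly.discr → ∀ᶠ Y in 𝓝 X, Fn Y = Fn X) ∧
          (∀ C : Set ↥(lieOfForm (galAdicCompletionMap (L := L) (IsCMField.complexConj L) hw) (UnitaryGroup.placeForm H w.1)), IsCompact C → ∃ B : ℝ, ∀ X ∈ C,
              ((NNReal.sqrt (NNReal.sqrt (normAbs (w.1.adicCompletion L) X.1.charpoly.discr)) : ℝ≥0) : ℝ) * ‖Fn X‖ ≤ B) := by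
  classical
  haveI : Algebra.IsQuadraticExtension ↥(maximalRealSubfield L) L := IsCMField.isQuadraticExtension L
  have hc1 := IsCMField.complexConj_ne_one L
  have hσσ : ∀ x, galAdicCompletionMap (L := L) (IsCMField.complexConj L) hw (galAdicCompletionMap (L := L) (IsCMField.complexConj L) hw x) = x :=
    galAdicCompletionMap_galAdicCompletionMap_of_smul_eq (IsCMField.complexConj L) w hc1 hw
  have h2 : (2 : w.1.adicCompletion L) ≠ 0 := two_ne_zero
  have hJ : ((UnitaryGroup.placeForm H w.1).map (galAdicCompletionMap (L := L) (IsCMField.complexConj L) hw))ᵀ = UnitaryGroup.placeForm H w.1 := by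
    rw [← Matrix.transpose_map]
    exact Literature.NumberTheory.Rogawski1990.placeForm_map_transpose_of_hermitian L v w hw H hH
  have hJdet : (UnitaryGroup.placeForm H w.1).det ≠ 0 := by
    rw [show UnitaryGroup.placeForm H w.1 = (algebraMap L (w.1.adicCompletion L)).mapMatrix H from rfl, ← RingHom.map_det]
    exact (map_ne_zero _).2 hdet
  rcases anisotropic_or_exists_formCongr_eq_hyperbolic (galAdicCompletionMap (L := L) (IsCMField.complexConj L) hw) hσσ h2 hJ hJdet with hanis | ⟨P, hP⟩
  · exact u2_nilpotentFourierRegular_of_anisotropic L v w hw H hH hdet hanis ψ hψ hψι μ𝔤 T hT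
  · letI : MeasurableSpace ↥(lieOfForm (galAdicCompletionMap (L := L) (IsCMField.complexConj L) hw) (formCongr (galAdicCompletionMap (L := L) (IsCMField.complexConj L) hw) P (UnitaryGroup.placeForm H w.1))) := borel _
    haveI : BorelSpace ↥(lieOfForm (galAdicCompletionMap (L := L) (IsCMField.complexConj L) hw) (formCongr (galAdicCompletionMap (L := L) (IsCMField.complexConj L) hw) P (UnitaryGroup.placeForm H w.1))) := ⟨rfl⟩
    exact nilpotentFourierRegular_of_formCongr (galAdicCompletionMap (L := L) (IsCMField.complexConj L) hw) (UnitaryGroup.placeForm H w.1) P (fun x : w.1.adicCompletion L => ((ψ x : Circle) : ℂ))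
      (fun x : w.1.adicCompletion L => ((NNReal.sqrt (NNReal.sqrt (normAbs (w.1.adicCompletion L) x)) : ℝ≥0) : ℝ))
      (fun μ' _ T' hT' => hyperbolic_nilpotentFourierRegular_of_gl2Nm L v w hw ψ hψ hψι hGL _ hP μ' T' hT') μ𝔤 T hT

end Summit.HodgeConjecture.HodgeConjecture.Cruxes.H413.K2E3U2NilpotentFourierRegularOfGL2

end
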